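import Mathlib
import HarnessLib
import Summits.ValiantsHypothesis.ValiantsHypothesis.Theorems.LacunarySymmetroidMatrixDescartesOsculationLawPeelBranchUnique
import Summits.ValiantsHypothesis.ValiantsHypothesis.Theorems.LacunarySymmetroidMatrixDescartesOsculationLawPeelExtend
import Summits.ValiantsHypothesis.ValiantsHypothesis.Theorems.LacunarySymmetroidMatrixDescartesOsculationLawPeelNoOscillation

/-!
# ValiantsHypothesis / LacunarySymmetroid — crux `MatrixDescartes` (stmt-ValiantsHypothesis-18050, V1),
# line `Cruxes/MatrixDescartes/Lines/osculation_law.lean` («osculation-law»), stub `stub_peel` (ALL ranks):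
# THE MAXIMAL RIGHT CONTINUATION OF A BRANCH (rank-free; the sup-packaging of piece (α) of
# NOTE-p7g12-peel-general-r-sizing.md, right side)

From a curve point `(t₀, b₀)` of the open quadrant (hyperbolic vertical family, finite osculation set, GP) the continuous
positive solution through it continues to the right MAXIMALLY: either for ever, or up to an abscissa `ω > t₀` where it
tends to `0` (a ZERO end: then `Φ(ω, 0) = 0`, `…PeelExtend.eval_eq_zero_of_tendsto`) or to `+∞` (an ESCAPE end:
`…PeelEscapeEnd`).  Assembly of the landed toolkit: local branch (existence), `branch_unique_of_hyperbolic` (gluing),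
`exists_extension_of_tendsto` (a finite positive limit is not an end), `not_oscillating_end` (a bounded end has a limit).

* `tendsto_of_not_oscillating` — a positive function on a filter that never oscillates between two levels tends to `+∞`
  or to some `c ≥ 0` (liminf = limsup).
* **`exists_right_maximal_branch`** — the statement above.

Honest framing: a rank-free LEMMA toward the OPEN stub `stub_peel` (all `r`); nothing of the summit is proved; `VP ≠ VNP` is
NOT proved.  No definitions, no named facts.
-/

-- `Summit.ValiantsHypothesis.ValiantsHypothesis.…` is the tree's mandated single-conjunct layout (Sub = Summit).
set_option linter.dupNamespace false

noncomputable section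

namespace Summit.ValiantsHypothesis.ValiantsHypothesis.Theorems.LacunarySymmetroidMatrixDescartes

open Polynomial Set Filter
open MvPolynomial (pderiv)
open scoped BigOperators Topology

namespace OsculationPeel

/-- **No oscillation ⇒ a limit.**  A function, eventually positive along a non-trivial filter, which never comes `≤ b₁`
and `≥ b₂` frequently for any `b₁ < b₂`, tends to `+∞` or to some `c ≥ 0`. [folklore] -/
theorem tendsto_of_not_oscillating {F : Filter ℝ} [F.NeBot] {f : ℝ → ℝ} (hpos : ∀ᶠ t in F, 0 < f t)
    (hno : ∀ b₁ b₂ : ℝ, b₁ < b₂ → (∃ᶠ t in F, f t ≤ b₁) → (∃ᶠ t in F, b₂ ≤ f t) → False) :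
    Tendsto f F atTop ∨ ∃ c : ℝ, 0 ≤ c ∧ Tendsto f F (𝓝 c) := by
  by_cases htop : Tendsto f F atTop
  · exact Or.inl htop
  right
  -- not `→ +∞`: frequently below some `M`, hence (no oscillation) eventually `≤ M + 1`
  obtain ⟨M, hM⟩ : ∃ M, ∃ᶠ t in F, f t < M := by
    simp only [tendsto_atTop, not_forall, not_eventually, not_le] at htop
    exact htop
  have hbdd : ∀ᶠ t in F, f t ≤ M + 1 := by
    by_contra h
    have h' : ∃ᶠ t in F, M + 1 ≤ f t := (not_eventually.1 h).mono fun t ht => (not_le.1 ht).le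
    exact hno M (M + 1) (by linarith) (hM.mono fun t ht => ht.le) h'
  have hup : IsBoundedUnder (· ≤ ·) F f := isBoundedUnder_of_eventually_le hbdd
  have hlow : IsBoundedUnder (· ≥ ·) F f := isBoundedUnder_of_eventually_ge (hpos.mono fun t ht => ht.le)
  have hle : liminf f F ≤ limsup f F := liminf_le_limsup hup hlow
  rcases hle.lt_or_eq with hlt | heq
  · exfalso
    obtain ⟨b₁, h₁, h₁'⟩ := exists_between hlt
    obtain ⟨b₂, h₂, h₂'⟩ := exists_between h₁'
    exact hno b₁ b₂ h₂ ((frequently_lt_of_liminf_lt hup.isCoboundedUnder_ge h₁).mono fun t ht => ht.le)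
      ((frequently_lt_of_lt_limsup hlow.isCoboundedUnder_le h₂').mono fun t ht => ht.le)
  · have hlim : Tendsto f F (𝓝 (limsup f F)) := tendsto_of_liminf_eq_limsup heq rfl hup hlow
    exact ⟨limsup f F, ge_of_tendsto hlim (hpos.mono fun t ht => ht.le), hlim⟩

/-- **The maximal right continuation of a branch.**  Hyperbolic vertical family, finite osculation set, GP; from a curve
point `(t₀, b₀)` of the open quadrant there is a continuous positive solution `β` on the right with `β t₀ = b₀` which EITHER
lives on every `[t₀, T)`, OR lives on a maximal `[t₀, ω)` at whose end it tends to `0` (ZERO end) or to `+∞` (ESCAPE end).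
[folklore] -/
theorem exists_right_maximal_branch (Φ : MvPolynomial (Fin 2) ℝ) (P : ℝ → ℝ[X])
    (hP : ∀ t b, (P t).eval b = MvPolynomial.eval ![t, b] Φ) (hsplit : ∀ t, 0 < t → (P t).Splits)
    (hfin : {p : Fin 2 → ℝ | 0 < p 0 ∧ 0 < p 1 ∧ MvPolynomial.eval p Φ = 0 ∧
      MvPolynomial.eval p
        (MvPolynomial.X 0 * MvPolynomial.pderiv 0 (MvPolynomial.X 0 * MvPolynomial.pderiv 0 Φ)
            * (MvPolynomial.X 1 * MvPolynomial.pderiv 1 Φ) ^ 2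
          - 2 * (MvPolynomial.X 0 * MvPolynomial.pderiv 0 (MvPolynomial.X 1 * MvPolynomial.pderiv 1 Φ))
            * (MvPolynomial.X 0 * MvPolynomial.pderiv 0 Φ) * (MvPolynomial.X 1 * MvPolynomial.pderiv 1 Φ)
          + MvPolynomial.X 1 * MvPolynomial.pderiv 1 (MvPolynomial.X 1 * MvPolynomial.pderiv 1 Φ)
            * (MvPolynomial.X 0 * MvPolynomial.pderiv 0 Φ) ^ 2) = 0}.Finite)
    (hgp : ∀ p ∈ {p : Fin 2 → ℝ | 0 < p 0 ∧ 0 < p 1 ∧ MvPolynomial.eval p Φ = 0 ∧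
      MvPolynomial.eval p
        (MvPolynomial.X 0 * MvPolynomial.pderiv 0 (MvPolynomial.X 0 * MvPolynomial.pderiv 0 Φ)
            * (MvPolynomial.X 1 * MvPolynomial.pderiv 1 Φ) ^ 2
          - 2 * (MvPolynomial.X 0 * MvPolynomial.pderiv 0 (MvPolynomial.X 1 * MvPolynomial.pderiv 1 Φ))
            * (MvPolynomial.X 0 * MvPolynomial.pderiv 0 Φ) * (MvPolynomial.X 1 * MvPolynomial.pderiv 1 Φ)
          + MvPolynomial.X 1 * MvPolynomial.pderiv 1 (MvPolynomial.X 1 * MvPolynomial.pderiv 1 Φ)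
            * (MvPolynomial.X 0 * MvPolynomial.pderiv 0 Φ) ^ 2) = 0},
        MvPolynomial.eval p (MvPolynomial.pderiv 1 Φ) ≠ 0)
    {t₀ b₀ : ℝ} (ht₀ : 0 < t₀) (hb₀ : 0 < b₀) (hΦ : MvPolynomial.eval ![t₀, b₀] Φ = 0) :
    ∃ β : ℝ → ℝ, β t₀ = b₀ ∧
      ((∀ T, t₀ < T → ContinuousOn β (Ico t₀ T) ∧ ∀ t ∈ Ico t₀ T, 0 < β t ∧ MvPolynomial.eval ![t, β t] Φ = 0) ∨
       ∃ ω, t₀ < ω ∧ ContinuousOn β (Ico t₀ ω) ∧ (∀ t ∈ Ico t₀ ω, 0 < β t ∧ MvPolynomial.eval ![t, β t] Φ = 0) ∧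
         (Tendsto β (𝓝[<] ω) (𝓝 0) ∨ Tendsto β (𝓝[<] ω) atTop)) := by
  classical
  -- admissible right solutions: `Adm T γ`
  set S : Set ℝ := {T | t₀ < T ∧ ∃ γ : ℝ → ℝ, γ t₀ = b₀ ∧ ContinuousOn γ (Ico t₀ T) ∧
    ∀ t ∈ Ico t₀ T, 0 < γ t ∧ MvPolynomial.eval ![t, γ t] Φ = 0} with hSdef
  -- Step 1: `S` is nonempty (the local branch at `(t₀, b₀)`)
  have hne : S.Nonempty := by
    obtain ⟨ψ, hψ0, hψcd, hψsol, -⟩ := exists_local_branch_of_hyperbolic Φ P hP hsplit hfin hgp ht₀ hb₀ hΦ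
    have hψca : ∀ᶠ t in 𝓝 t₀, ContinuousAt ψ t := (hψcd.eventually (by simp)).mono fun t ht => ht.continuousAt
    have hψpos : ∀ᶠ t in 𝓝 t₀, 0 < ψ t := by
      have h := hψcd.continuousAt.tendsto
      rw [hψ0] at h
      exact h.eventually (Ioi_mem_nhds hb₀)
    obtain ⟨δ, hδ, h₁⟩ : ∃ δ > 0, ∀ t, dist t t₀ < δ →
        ContinuousAt ψ t ∧ MvPolynomial.eval ![t, ψ t] Φ = 0 ∧ 0 < ψ t :=
      Metric.eventually_nhds_iff.1 ((hψca.and hψsol).and hψpos |>.mono fun t h => ⟨h.1.1, h.1.2, h.2⟩)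
    have hd : ∀ t ∈ Ico t₀ (t₀ + δ), dist t t₀ < δ := fun t ht => by
      rw [Real.dist_eq, abs_lt]; constructor <;> linarith [ht.1, ht.2]
    refine ⟨t₀ + δ, by linarith, ψ, hψ0, fun t ht => (h₁ t (hd t ht)).1.continuousWithinAt,
      fun t ht => ⟨(h₁ t (hd t ht)).2.2, (h₁ t (hd t ht)).2.1⟩⟩
  -- Step 2: two admissible solutions agree on their common interval
  have huniq : ∀ T T' (γ γ' : ℝ → ℝ), (γ t₀ = b₀ ∧ ContinuousOn γ (Ico t₀ T) ∧
      ∀ t ∈ Ico t₀ T, 0 < γ t ∧ MvPolynomial.eval ![t, γ t] Φ = 0) →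
      (γ' t₀ = b₀ ∧ ContinuousOn γ' (Ico t₀ T') ∧ ∀ t ∈ Ico t₀ T', 0 < γ' t ∧ MvPolynomial.eval ![t, γ' t] Φ = 0) →
      ∀ t, t₀ ≤ t → t < T → t < T' → γ t = γ' t := by
    intro T T' γ γ' hγ hγ' t h0 hT hT'
    have hsub : Icc t₀ t ⊆ Ico t₀ T := fun u hu => ⟨hu.1, hu.2.trans_lt hT⟩
    have hsub' : Icc t₀ t ⊆ Ico t₀ T' := fun u hu => ⟨hu.1, hu.2.trans_lt hT'⟩
    exact branch_unique_of_hyperbolic Φ P hP hsplit hfin hgp ht₀ (left_mem_Icc.2 h0) (hγ.2.1.mono hsub)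
      (hγ'.2.1.mono hsub') (fun u hu => (hγ.2.2 u (hsub hu)).1) (fun u hu => (hγ.2.2 u (hsub hu)).2)
      (fun u hu => (hγ'.2.2 u (hsub' hu)).2) (hγ.1.trans hγ'.1.symm) (right_mem_Icc.2 h0)
  -- Step 3: the glued function
  have hw : ∀ T ∈ S, ∃ γ : ℝ → ℝ, γ t₀ = b₀ ∧ ContinuousOn γ (Ico t₀ T) ∧
      ∀ t ∈ Ico t₀ T, 0 < γ t ∧ MvPolynomial.eval ![t, γ t] Φ = 0 := fun T hT => hT.2
  let β : ℝ → ℝ := fun t =>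
    if h : ∃ T, T ∈ S ∧ t < T then Classical.choose (hw _ (Classical.choose_spec h).1) t else b₀
  have hβeq : ∀ T ∈ S, ∀ γ : ℝ → ℝ, (γ t₀ = b₀ ∧ ContinuousOn γ (Ico t₀ T) ∧
      ∀ t ∈ Ico t₀ T, 0 < γ t ∧ MvPolynomial.eval ![t, γ t] Φ = 0) → ∀ t ∈ Ico t₀ T, β t = γ t := by
    intro T hT γ hγ t ht
    have h : ∃ T, T ∈ S ∧ t < T := ⟨T, hT, ht.2⟩
    show (if h : ∃ T, T ∈ S ∧ t < T then Classical.choose (hw _ (Classical.choose_spec h).1) t else b₀) = γ t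
    rw [dif_pos h]
    exact huniq _ _ _ _ (Classical.choose_spec (hw _ (Classical.choose_spec h).1)) hγ t ht.1
      (Classical.choose_spec h).2 ht.2
  have hβadm : ∀ T ∈ S, β t₀ = b₀ ∧ ContinuousOn β (Ico t₀ T) ∧
      ∀ t ∈ Ico t₀ T, 0 < β t ∧ MvPolynomial.eval ![t, β t] Φ = 0 := by
    intro T hT
    obtain ⟨γ, hγ⟩ := hw T hT
    have hE : EqOn β γ (Ico t₀ T) := fun t ht => hβeq T hT γ hγ t ht
    refine ⟨?_, hγ.2.1.congr hE, fun t ht => ?_⟩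
    · rw [hE ⟨le_rfl, hT.1⟩, hγ.1]
    · rw [hE ht]; exact hγ.2.2 t ht
  have hβ0 : β t₀ = b₀ := by
    obtain ⟨T, hT⟩ := hne
    exact (hβadm T hT).1
  refine ⟨β, hβ0, ?_⟩
  by_cases hbdd : BddAbove S
  · -- Step 4: `ω = sup S` is an end of the branch
    right
    set ω := sSup S with hω
    obtain ⟨T₁, hT₁⟩ := hne
    have ht₀ω : t₀ < ω := hT₁.1.trans_le (le_csSup hbdd hT₁)
    have hωpos : 0 < ω := ht₀.trans ht₀ω
    have hloc : ∀ t ∈ Ico t₀ ω, ∃ T ∈ S, t < T := fun t ht => exists_lt_of_lt_csSup ⟨T₁, hT₁⟩ ht.2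
    have hcontω : ContinuousOn β (Ico t₀ ω) := by
      intro t ht
      obtain ⟨T, hT, htT⟩ := hloc t ht
      have h := (hβadm T hT).2.1 t ⟨ht.1, htT⟩
      refine h.mono_of_mem_nhdsWithin ?_
      exact mem_of_superset (inter_mem_nhdsWithin (Ico t₀ ω) (Iio_mem_nhds htT)) fun u hu => ⟨hu.1.1, hu.2⟩
    have hsolω : ∀ t ∈ Ico t₀ ω, 0 < β t ∧ MvPolynomial.eval ![t, β t] Φ = 0 := by
      intro t ht
      obtain ⟨T, hT, htT⟩ := hloc t ht
      exact (hβadm T hT).2.2 t ⟨ht.1, htT⟩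
    refine ⟨ω, ht₀ω, hcontω, hsolω, ?_⟩
    -- the end behaviour: no oscillation ⇒ a limit in `[0, ∞]`; a finite positive limit would extend the branch past `ω`
    have hcontIoo : ContinuousOn β (Ioo t₀ ω) := hcontω.mono Ioo_subset_Ico_self
    have hsolIoo : ∀ t ∈ Ioo t₀ ω, MvPolynomial.eval ![t, β t] Φ = 0 := fun t ht => (hsolω t ⟨ht.1.le, ht.2⟩).2
    have hposF : ∀ᶠ t in 𝓝[<] ω, 0 < β t :=
      mem_of_superset (Ioo_mem_nhdsLT ht₀ω) fun t ht => (hsolω t ⟨ht.1.le, ht.2⟩).1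
    rcases tendsto_of_not_oscillating hposF (fun b₁ b₂ hb h₁ h₂ =>
        not_oscillating_end Φ P hP hfin hωpos ht₀ω hb hcontIoo hsolIoo h₁ h₂) with htop | ⟨c, hc0, hc⟩
    · exact Or.inr htop
    rcases hc0.lt_or_eq with hcpos | hczero
    · -- finite positive limit: extend past `ω`, contradicting `ω = sup S`
      exfalso
      obtain ⟨δ, hδ, β', hβ'eq, -, hβ'cont, hβ'sol, hβ'pos⟩ :=
        exists_extension_of_tendsto Φ P hP hsplit hfin hgp hωpos ht₀ω hcpos hcontIoo hsolIoo hc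
      -- the glued extension `γ`
      let γ : ℝ → ℝ := fun t => if t < ω then β t else β' t
      have hγβ' : ∀ u ∈ Ioo t₀ (ω + δ), γ u = β' u := by
        intro u hu
        by_cases huω : u < ω
        · simp only [γ, if_pos huω]; exact (hβ'eq u ⟨hu.1, huω⟩).symm
        · simp only [γ, if_neg huω]
      have hγβ : ∀ u, u < ω → γ u = β u := fun u hu => by simp only [γ, if_pos hu]
      have hmem : ω + δ ∈ S := by
        refine ⟨by linarith, γ, by rw [hγβ t₀ ht₀ω, hβ0], ?_, ?_⟩
        · intro t ht
          rcases eq_or_lt_of_le ht.1 with rfl | hlt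
          · -- at `t₀`: locally `β` within the interval
            have h := (hcontω t₀ ⟨le_rfl, ht₀ω⟩).mono_of_mem_nhdsWithin (s := Ico t₀ (ω + δ)) (by
              exact mem_of_superset (inter_mem_nhdsWithin (Ico t₀ (ω + δ)) (Iio_mem_nhds ht₀ω))
                fun u hu => ⟨hu.1.1, hu.2⟩)
            refine h.congr_of_eventuallyEq ?_ (hγβ t₀ ht₀ω)
            exact mem_of_superset (mem_nhdsWithin_of_mem_nhds (Iio_mem_nhds ht₀ω)) fun u hu => hγβ u hu
          · -- right of `t₀`: locally `β'`
            have hβ't : ContinuousAt β' t := (hβ'cont t ⟨hlt, ht.2⟩).continuousAt (Ioo_mem_nhds hlt ht.2)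
            refine (hβ't.congr ?_).continuousWithinAt
            exact mem_of_superset (Ioo_mem_nhds hlt ht.2) fun u hu => (hγβ' u hu).symm
        · intro t ht
          by_cases htω : t < ω
          · rw [hγβ t htω]; exact hsolω t ⟨ht.1, htω⟩
          · push Not at htω
            rw [hγβ' t ⟨ht₀ω.trans_le htω, ht.2⟩]
            exact ⟨hβ'pos t ⟨htω, ht.2⟩, hβ'sol t ⟨ht₀ω.trans_le htω, ht.2⟩⟩
      have : ω + δ ≤ ω := le_csSup hbdd hmem
      linarith
    · left
      rw [← hczero] at hc  -- careful: `hczero : 0 = c`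
      exact hc
  · -- Step 4': `S` unbounded: the branch lives on every `[t₀, T)`
    left
    intro T hT
    obtain ⟨T', hT'S, hTT'⟩ := not_bddAbove_iff.1 hbdd T
    have hTS : T ∈ S := by
      obtain ⟨γ, hγ0, hγc, hγs⟩ := hT'S.2
      exact ⟨hT, γ, hγ0, hγc.mono (Ico_subset_Ico_right hTT'.le), fun t ht => hγs t ⟨ht.1, ht.2.trans hTT'⟩⟩
    exact ⟨(hβadm T hTS).2.1, (hβadm T hTS).2.2⟩

end OsculationPeel

end Summit.ValiantsHypothesis.ValiantsHypothesis.Theorems.LacunarySymmetroidMatrixDescartes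

end
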